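import Mathlib.Analysis.SpecialFunctions.Complex.LogDeriv
import Mathlib.Analysis.SpecialFunctions.Complex.Arg
import Mathlib.Analysis.Complex.Convex
import Literature.Geometry.Kaehler.PoincareLemmaStarConvex
import Literature.Topology.FourManifolds.TorusCoordinates
import HarnessLib

/-!
# Closed `1`-forms on a punctured disc: `β = κ dϑ + dh` (the wrapping number)

Topic `Literature/Geometry/Symplectic`; proofs file of the fact seat of
`Literature.Geometry.Symplectic.mclean_divisorComplement_convex_four` (M. McLean, *The growth
rate of symplectic homology and affine varieties*, GAFA 22 (2012), Lemma 5.17), layer "wrapping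
number".  McLean (p. 36 of arXiv:1011.2542v3) defines the wrapping number `κ` of a primitive
`θ` of the symplectic form around a codimension-`2` symplectic submanifold by restricting `θ` to
a small symplectic disc `𝔻_δ` meeting the submanifold orthogonally at its centre: "We have that
`dθ = r dr ∧ dϑ` on the punctured disk `𝔻_δ ∖ {0}`.  Hence `θ` is cohomologous to
`(r²/2) dϑ + κ dϑ` for some constant `κ`."  The step used is the computation of the first
de Rham cohomology of the punctured disc, `H¹_dR(𝔻_δ ∖ {0}) = ℝ · [dϑ]` (Bott–Tu 1982, §I.4,
Example 4.6 ff.; Lee 2013, Problem 17-3 / Cor. 17.24 region): **every smooth closed `1`-form on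
a punctured disc is `κ dϑ + dh` for a unique real `κ` and a smooth `h`**.

This file proves it in Mathlib's flat vocabulary (`extDeriv` of forms
`ℂ → ℂ [⋀^Fin n]→L[ℝ] ℝ` on the real normed plane `ℂ`), by the Mayer–Vietoris argument with the
two slit discs `𝔻_δ ∖ (-∞, 0]` and `𝔻_δ ∖ [0, ∞)` (star-shaped, so the tree's Poincaré lemma
`exists_extDeriv_eq_of_starConvex` / `eq_of_extDeriv_eq_zero_of_starConvex` applies) whose
intersection is the two open half discs, and the two branches `arg z`, `arg (-z) + π` of the
angle, which differ by `0` on the upper and by `2π` on the lower half disc: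

* `angular_apply` — the angular form `dϑ_x(v) = Im(v/x) = (x₁ v₂ - x₂ v₁)/|x|²`, written
  `ofSubsingleton ℝ ℂ ℝ 0 (imCLM ∘L (x⁻¹ • 1))`;
* `hasFDerivAt_arg`, `hasFDerivAt_arg_neg_add_pi` — `d(arg) = dϑ` on the slit plane
  (Mathlib's `hasStrictFDerivAt_log_real` and `log_im`; real smoothness of `arg` is the tree's
  `Literature.Topology.FourManifolds.contDiffAt_arg`), and the same for `arg (-z) + π` on the
  opposite slit plane;
* `exists_eq_smul_angular_add_extDeriv` — **existence**: `β = κ dϑ + dh` on `𝔻_δ ∖ {0}`;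
* `smul_angular_unique` — **uniqueness of `κ`**: if `κ dϑ + dh = κ' dϑ + dh'` on `𝔻_δ ∖ {0}`
  then `κ = κ'` (`dϑ` is not exact: a primitive would differ from the two angle branches by
  constants, contradicting the jump `2π`).

Everything is proved; no definitions, no named facts (D-0026).

## References

* M. McLean, *The growth rate of symplectic homology and affine varieties*, Geom. Funct. Anal. 22
  (2012), p. 36 (definition of the wrapping number). [Mclean2012]
* R. Bott, L. W. Tu, *Differential Forms in Algebraic Topology*, GTM 82 (1982), §I.2 (Mayer–
  Vietoris), §I.4 (Poincaré lemma). [BottTu1982Forms]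
* J. M. Lee, *Introduction to Smooth Manifolds*, 2nd ed. (2013), Thm. 17.14.
  [LeeSmoothManifolds2013]
-/

noncomputable section

open scoped Topology ContDiff Real
open Set Filter Complex ContinuousAlternatingMap Metric

namespace Literature.Geometry.Symplectic

open Literature.Geometry.Kaehler
open Literature.Topology.FourManifolds (contDiffAt_arg)

/-! ### The angular form `dϑ` and the angle branches -/

/-- **The angular form.** `dϑ_x(v) = Im(x⁻¹ v) = (x₁ v₂ - x₂ v₁) / |x|²` (the form
`(x dy - y dx)/(x² + y²)`; Bott–Tu 1982, §I.4). [folklore] -/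
theorem angular_apply (x v : ℂ) :
    ofSubsingleton ℝ ℂ ℝ (0 : Fin 1) (imCLM.comp (x⁻¹ • (1 : ℂ →L[ℝ] ℂ))) ![v] =
      (x.re * v.im - x.im * v.re) / (x.re ^ 2 + x.im ^ 2) := by
  change (x⁻¹ * v).im = _
  simp only [mul_im, inv_re, inv_im, normSq_apply]
  ring

/-- **`d(arg) = dϑ` on the slit plane**: `arg` is real-differentiable at `x ∈ ℂ ∖ (-∞, 0]`
with derivative `v ↦ Im(x⁻¹ v)` (`arg = Im ∘ log` and Mathlib's `hasStrictFDerivAt_log_real`).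
[folklore] -/
theorem hasFDerivAt_arg {x : ℂ} (hx : x ∈ slitPlane) :
    HasFDerivAt arg (imCLM.comp (x⁻¹ • (1 : ℂ →L[ℝ] ℂ))) x := by
  have h : arg = fun z ↦ imCLM (log z) := funext fun z ↦ by simp [log_im]
  rw [h]
  exact imCLM.hasFDerivAt.comp x (hasStrictFDerivAt_log_real hx).hasFDerivAt

/-- **The opposite branch `arg (-z) + π`** is real-differentiable at `x` with `-x` in the slit
plane, with the same derivative `dϑ_x`. [folklore] -/
theorem hasFDerivAt_arg_neg_add_pi {x : ℂ} (hx : -x ∈ slitPlane) :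
    HasFDerivAt (fun z ↦ arg (-z) + π) (imCLM.comp (x⁻¹ • (1 : ℂ →L[ℝ] ℂ))) x := by
  have h1 : HasFDerivAt (fun z : ℂ ↦ -z) (-(ContinuousLinearMap.id ℝ ℂ)) x :=
    (hasFDerivAt_id (𝕜 := ℝ) x).neg
  have h2 := ((hasFDerivAt_arg hx).comp x h1).add_const π
  refine h2.congr_fderiv ?_
  ext v
  change ((-x)⁻¹ * -v).im = (x⁻¹ * v).im
  rw [inv_neg, neg_mul_neg]

/-- `arg (-z) + π` is `C^∞` at `x` when `-x` is in the slit plane. [folklore] -/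
theorem contDiffAt_arg_neg_add_pi {x : ℂ} (hx : -x ∈ slitPlane) :
    ContDiffAt ℝ ∞ (fun z ↦ arg (-z) + π) x :=
  ((contDiffAt_arg hx).comp x contDiff_neg.contDiffAt).add contDiffAt_const

/-- The two branches agree on the upper half plane: `arg (-z) + π = arg z` for `Im z > 0`.
[folklore] -/
theorem arg_neg_add_pi_of_im_pos {z : ℂ} (hz : 0 < z.im) : arg (-z) + π = arg z := by
  rw [arg_neg_eq_arg_sub_pi_of_im_pos hz]; ring

/-- The two branches differ by `2π` on the lower half plane: `arg (-z) + π = arg z + 2π` for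
`Im z < 0`. [folklore] -/
theorem arg_neg_add_pi_of_im_neg {z : ℂ} (hz : z.im < 0) : arg (-z) + π = arg z + 2 * π := by
  rw [arg_neg_eq_arg_add_pi_of_im_neg hz]; ring

/-- `d` of the `0`-form of a differentiable function is its differential. [folklore] -/
theorem extDeriv_constOfIsEmpty_eq_of_hasFDerivAt {f : ℂ → ℝ} {x : ℂ} {f' : ℂ →L[ℝ] ℝ}
    (hf : HasFDerivAt f f' x) :
    extDeriv (fun z ↦ constOfIsEmpty ℝ ℂ (Fin 0) (f z)) x =
      ofSubsingleton ℝ ℂ ℝ (0 : Fin 1) f' := by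
  rw [extDeriv_constOfIsEmpty, hf.fderiv]

/-- The `0`-form of a `C^∞` function is `C^∞` (at a point). [folklore] -/
theorem contDiffAt_constOfIsEmpty {f : ℂ → ℝ} {x : ℂ} (hf : ContDiffAt ℝ ∞ f x) :
    ContDiffAt ℝ ∞ (fun z ↦ constOfIsEmpty ℝ ℂ (Fin 0) (f z)) x :=
  (constOfIsEmptyLIE ℝ ℂ ℝ (Fin 0)).contDiff.contDiffAt.comp x hf

/-- A `0`-form value is the constant `0`-form of its value on the empty tuple. [folklore] -/
theorem eq_constOfIsEmpty_apply (g : ℂ [⋀^Fin 0]→L[ℝ] ℝ) :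
    g = constOfIsEmpty ℝ ℂ (Fin 0) (g ![]) := by
  ext v
  rw [constOfIsEmpty_apply, Subsingleton.elim v ![]]

/-- `d` of a constant form vanishes. [folklore] -/
theorem extDeriv_const_eq_zero {n : ℕ} (c : ℂ [⋀^Fin n]→L[ℝ] ℝ) (x : ℂ) :
    extDeriv (fun _ : ℂ ↦ c) x = 0 := by
  simp only [extDeriv, fderiv_fun_const, Pi.zero_apply]
  exact map_zero (ContinuousAlternatingMap.alternatizeUncurryFinCLM ℝ ℂ ℝ)

/-! ### Existence: `β = κ dϑ + dh` -/

/-- **Closed `1`-forms on a punctured disc are `κ dϑ + dh`** (`H¹_dR(𝔻 ∖ 0) = ℝ[dϑ]`;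
McLean 2012, p. 36: "Hence `θ` is cohomologous to `(r²/2) dϑ + κ dϑ` for some constant `κ`";
Bott–Tu 1982, §I.4).  For a `1`-form `β` on the plane `ℂ`, `C^∞` and closed on the punctured
disc `𝔻_δ ∖ {0}`, there are `κ : ℝ` and a `0`-form `h`, `C^∞` on the punctured disc, with
`β = κ dϑ + dh` there, `dϑ_x = Im(x⁻¹ ·)` being the angular form (`angular_apply`).  Proof:
Poincaré lemma on the two star-shaped slit discs, comparison of the two primitives on the two
half discs (constants `c₊`, `c₋`), `κ = (c₊ - c₋)/2π`, and `h` glued from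
`γ₁ - κ arg`, `γ₂ - κ (arg(-·) + π) + c₊`. [cite: Mclean2012, p. 36 (wrapping number)] -/
theorem exists_eq_smul_angular_add_extDeriv {δ : ℝ} {β : ℂ → ℂ [⋀^Fin 1]→L[ℝ] ℝ}
    (hβ : ContDiffOn ℝ ∞ β (ball (0 : ℂ) δ \ {0}))
    (hd : ∀ x ∈ ball (0 : ℂ) δ \ {0}, extDeriv β x = 0) :
    ∃ (κ : ℝ) (h : ℂ → ℂ [⋀^Fin 0]→L[ℝ] ℝ), ContDiffOn ℝ ∞ h (ball (0 : ℂ) δ \ {0}) ∧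
      ∀ x ∈ ball (0 : ℂ) δ \ {0}, β x =
        κ • ofSubsingleton ℝ ℂ ℝ (0 : Fin 1) (imCLM.comp (x⁻¹ • (1 : ℂ →L[ℝ] ℂ))) +
          extDeriv h x := by
  classical
  rcases le_or_gt δ 0 with hδ | hδ
  · refine ⟨0, fun _ ↦ 0, contDiffOn_const, fun x hx ↦ ?_⟩
    have : x ∈ ball (0 : ℂ) δ := hx.1
    rw [Metric.mem_ball] at this
    linarith [dist_nonneg (x := x) (y := (0 : ℂ))]
  -- the sets
  set P : Set ℂ := ball (0 : ℂ) δ \ {0} with hP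
  set U₁ : Set ℂ := ball (0 : ℂ) δ ∩ slitPlane with hU₁
  set U₂ : Set ℂ := ball (0 : ℂ) δ ∩ -slitPlane with hU₂
  set Hp : Set ℂ := ball (0 : ℂ) δ ∩ {z | 0 < z.im} with hHp
  set Hm : Set ℂ := ball (0 : ℂ) δ ∩ {z | z.im < 0} with hHm
  have hU₁o : IsOpen U₁ := isOpen_ball.inter isOpen_slitPlane
  have hU₂o : IsOpen U₂ := isOpen_ball.inter isOpen_slitPlane.neg
  have hHpo : IsOpen Hp := isOpen_ball.inter (isOpen_lt continuous_const continuous_im)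
  have hHmo : IsOpen Hm := isOpen_ball.inter (isOpen_lt continuous_im continuous_const)
  have ha : ((δ / 2 : ℝ) : ℂ) ∈ ball (0 : ℂ) δ := by
    rw [Metric.mem_ball, dist_zero_right, norm_real, Real.norm_eq_abs, abs_of_pos (by positivity)]
    linarith
  have hU₁s : StarConvex ℝ ((δ / 2 : ℝ) : ℂ) U₁ :=
    ((convex_ball (0 : ℂ) δ).starConvex ha).inter (starConvex_ofReal_slitPlane (by positivity))
  have hU₂s : StarConvex ℝ (-((δ / 2 : ℝ) : ℂ)) U₂ := by
    refine ((convex_ball (0 : ℂ) δ).starConvex ?_).inter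
      (starConvex_ofReal_slitPlane (by positivity : (0 : ℝ) < δ / 2)).neg
    rw [Metric.mem_ball, dist_zero_right, norm_neg, norm_real, Real.norm_eq_abs,
      abs_of_pos (by positivity)]
    linarith
  have hpI : ((δ / 2 : ℝ) : ℂ) * I ∈ Hp := by
    refine ⟨?_, ?_⟩
    · rw [Metric.mem_ball, dist_zero_right, norm_mul, norm_I, mul_one, norm_real,
        Real.norm_eq_abs, abs_of_pos (by positivity)]
      linarith
    · show 0 < (((δ / 2 : ℝ) : ℂ) * I).im
      simp; positivity
  have hmI : -(((δ / 2 : ℝ) : ℂ) * I) ∈ Hm := by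
    refine ⟨?_, ?_⟩
    · rw [Metric.mem_ball, dist_zero_right, norm_neg, norm_mul, norm_I, mul_one, norm_real,
        Real.norm_eq_abs, abs_of_pos (by positivity)]
      linarith
    · show (-(((δ / 2 : ℝ) : ℂ) * I)).im < 0
      simp; positivity
  have hHps : StarConvex ℝ (((δ / 2 : ℝ) : ℂ) * I) Hp :=
    ((convex_ball (0 : ℂ) δ).inter (convex_halfSpace_im_gt 0)).starConvex hpI
  have hHms : StarConvex ℝ (-(((δ / 2 : ℝ) : ℂ) * I)) Hm :=
    ((convex_ball (0 : ℂ) δ).inter (convex_halfSpace_im_lt 0)).starConvex hmI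
  -- inclusions
  have hU₁P : U₁ ⊆ P := fun z hz ↦ ⟨hz.1, slitPlane_ne_zero hz.2⟩
  have hU₂P : U₂ ⊆ P := fun z hz ↦ ⟨hz.1, fun h0 ↦ by
    have : -z ∈ slitPlane := hz.2
    rw [show z = 0 from h0, neg_zero] at this
    exact slitPlane_ne_zero this rfl⟩
  have hHpU₁ : Hp ⊆ U₁ := fun z hz ↦ ⟨hz.1, Or.inr (ne_of_gt hz.2)⟩
  have hHmU₁ : Hm ⊆ U₁ := fun z hz ↦ ⟨hz.1, Or.inr (ne_of_lt hz.2)⟩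
  have hHpU₂ : Hp ⊆ U₂ := fun z hz ↦ ⟨hz.1, Or.inr (by
    show (-z).im ≠ 0
    rw [neg_im]; exact neg_ne_zero.2 (ne_of_gt hz.2))⟩
  have hHmU₂ : Hm ⊆ U₂ := fun z hz ↦ ⟨hz.1, Or.inr (by
    show (-z).im ≠ 0
    rw [neg_im]; exact neg_ne_zero.2 (ne_of_lt hz.2))⟩
  have hPU : ∀ z ∈ P, z ∈ U₁ ∨ z ∈ U₂ := fun z hz ↦
    (mem_slitPlane_or_neg_mem_slitPlane hz.2).imp (fun h ↦ ⟨hz.1, h⟩) (fun h ↦ ⟨hz.1, h⟩)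
  have him : ∀ z ∈ U₁ ∩ U₂, z ∈ Hp ∨ z ∈ Hm := by
    rintro z ⟨⟨hzb, hz1⟩, ⟨-, hz2⟩⟩
    have hz2' : -z ∈ slitPlane := hz2
    rcases lt_trichotomy 0 z.im with hi | hi | hi
    · exact Or.inl ⟨hzb, hi⟩
    · exfalso
      rcases hz1 with h1 | h1
      · rcases hz2' with h2 | h2
        · rw [neg_re] at h2; linarith
        · exact h2 (by rw [neg_im, ← hi, neg_zero])
      · exact h1 hi.symm
    · exact Or.inr ⟨hzb, hi⟩
  -- Poincaré lemma on the two slit discs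
  obtain ⟨γ₁, hγ₁, hdγ₁⟩ := exists_extDeriv_eq_of_starConvex hU₁o hU₁s (hβ.mono hU₁P)
    (fun x hx ↦ hd x (hU₁P hx))
  obtain ⟨γ₂, hγ₂, hdγ₂⟩ := exists_extDeriv_eq_of_starConvex hU₂o hU₂s (hβ.mono hU₂P)
    (fun x hx ↦ hd x (hU₂P hx))
  -- the difference is locally constant on the two half discs
  set D : ℂ → ℂ [⋀^Fin 0]→L[ℝ] ℝ := γ₁ + (-1 : ℝ) • γ₂ with hDdef
  have hD12 : ContDiffOn ℝ ∞ D (U₁ ∩ U₂) := by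
    have h1 : ContDiffOn ℝ ∞ γ₁ (U₁ ∩ U₂) := hγ₁.mono inter_subset_left
    have h2 : ContDiffOn ℝ ∞ (fun y ↦ (-1 : ℝ) • γ₂ y) (U₁ ∩ U₂) :=
      (hγ₂.mono inter_subset_right).const_smul _
    exact h1.add h2
  have hdD : ∀ x ∈ U₁ ∩ U₂, extDeriv D x = 0 := by
    rintro x ⟨hx1, hx2⟩
    have h1 : DifferentiableAt ℝ γ₁ x :=
      (hγ₁.contDiffAt (hU₁o.mem_nhds hx1)).differentiableAt (by simp)
    have h2 : DifferentiableAt ℝ γ₂ x :=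
      (hγ₂.contDiffAt (hU₂o.mem_nhds hx2)).differentiableAt (by simp)
    rw [hDdef, extDeriv_add h1 (h2.const_smul _), extDeriv_smul, hdγ₁ x hx1, hdγ₂ x hx2]
    simp
  have hDp : ∀ z ∈ Hp, D z = D (((δ / 2 : ℝ) : ℂ) * I) := fun z hz ↦
    eq_of_extDeriv_eq_zero_of_starConvex hHpo hHps
      ((hD12.mono fun w hw ↦ ⟨hHpU₁ hw, hHpU₂ hw⟩).differentiableOn (by simp))
      (fun w hw ↦ hdD w ⟨hHpU₁ hw, hHpU₂ hw⟩) hz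
  have hDm : ∀ z ∈ Hm, D z = D (-(((δ / 2 : ℝ) : ℂ) * I)) := fun z hz ↦
    eq_of_extDeriv_eq_zero_of_starConvex hHmo hHms
      ((hD12.mono fun w hw ↦ ⟨hHmU₁ hw, hHmU₂ hw⟩).differentiableOn (by simp))
      (fun w hw ↦ hdD w ⟨hHmU₁ hw, hHmU₂ hw⟩) hz
  set cp : ℝ := D (((δ / 2 : ℝ) : ℂ) * I) ![] with hcp
  set cm : ℝ := D (-(((δ / 2 : ℝ) : ℂ) * I)) ![] with hcm
  set κ : ℝ := (cp - cm) / (2 * π) with hκ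
  have hκ2 : 2 * π * κ = cp - cm := by
    rw [hκ]; field_simp
  -- the angle branches as `0`-forms
  set Θ₁ : ℂ → ℂ [⋀^Fin 0]→L[ℝ] ℝ := fun z ↦ constOfIsEmpty ℝ ℂ (Fin 0) (arg z) with hΘ₁
  set Θ₂ : ℂ → ℂ [⋀^Fin 0]→L[ℝ] ℝ := fun z ↦ constOfIsEmpty ℝ ℂ (Fin 0) (arg (-z) + π) with hΘ₂
  set Cp : ℂ [⋀^Fin 0]→L[ℝ] ℝ := D (((δ / 2 : ℝ) : ℂ) * I) with hCp
  -- the glued primitive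
  set h : ℂ → ℂ [⋀^Fin 0]→L[ℝ] ℝ := fun z ↦
    if z ∈ slitPlane then γ₁ z + (-κ) • Θ₁ z else γ₂ z + (-κ) • Θ₂ z + Cp with hh
  have hh1 : ∀ z ∈ U₁, h z = γ₁ z + (-κ) • Θ₁ z := fun z hz ↦ by
    simp only [hh, if_pos hz.2]
  have hh2 : ∀ z ∈ U₂, h z = γ₂ z + (-κ) • Θ₂ z + Cp := by
    intro z hz
    by_cases hz1 : z ∈ slitPlane
    · rw [hh1 z ⟨hz.1, hz1⟩]
      have hDz : D z = γ₁ z - γ₂ z := by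
        show γ₁ z + (-1 : ℝ) • γ₂ z = γ₁ z - γ₂ z
        rw [neg_one_smul, sub_eq_add_neg]
      rcases him z ⟨⟨hz.1, hz1⟩, hz⟩ with hzp | hzm
      · -- upper half disc: `γ₁ - γ₂ = Cp`, `Θ₂ = Θ₁`
        have hΘ : Θ₂ z = Θ₁ z := by
          simp only [hΘ₁, hΘ₂, arg_neg_add_pi_of_im_pos hzp.2]
        have hC : γ₁ z - γ₂ z = Cp := by rw [← hDz, hDp z hzp]
        rw [hΘ, ← hC]
        abel
      · -- lower half disc: `γ₁ - γ₂ = Cm`, `Θ₂ = Θ₁ + 2π`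
        have hΘ : Θ₂ z = Θ₁ z + constOfIsEmpty ℝ ℂ (Fin 0) (2 * π) := by
          ext v
          simp [hΘ₁, hΘ₂, arg_neg_add_pi_of_im_neg hzm.2]
        have hC : γ₁ z - γ₂ z = D (-(((δ / 2 : ℝ) : ℂ) * I)) := by rw [← hDz, hDm z hzm]
        rw [eq_constOfIsEmpty_apply (D (-(((δ / 2 : ℝ) : ℂ) * I))), ← hcm] at hC
        have hCp' : Cp = constOfIsEmpty ℝ ℂ (Fin 0) cp := by
          rw [hCp, hcp]; exact eq_constOfIsEmpty_apply _
        have hγ₁z : γ₁ z = γ₂ z + constOfIsEmpty ℝ ℂ (Fin 0) cm := by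
          rw [← hC]; abel
        rw [hΘ, hCp', hγ₁z]
        ext v
        simp only [ContinuousAlternatingMap.add_apply, ContinuousAlternatingMap.smul_apply,
          constOfIsEmpty_apply, smul_eq_mul]
        linear_combination hκ2
    · simp only [hh, if_neg hz1]
  -- smoothness of `h`
  have hΘ₁c : ∀ z ∈ U₁, ContDiffAt ℝ ∞ Θ₁ z := fun z hz ↦
    contDiffAt_constOfIsEmpty (contDiffAt_arg hz.2)
  have hΘ₂c : ∀ z ∈ U₂, ContDiffAt ℝ ∞ Θ₂ z := fun z hz ↦
    contDiffAt_constOfIsEmpty (contDiffAt_arg_neg_add_pi hz.2)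
  have hF1 : ∀ z ∈ U₁, ContDiffAt ℝ ∞ (fun w ↦ γ₁ w + (-κ) • Θ₁ w) z := fun z hz ↦
    (hγ₁.contDiffAt (hU₁o.mem_nhds hz)).add ((hΘ₁c z hz).const_smul _)
  have hF2 : ∀ z ∈ U₂, ContDiffAt ℝ ∞ (fun w ↦ γ₂ w + (-κ) • Θ₂ w + Cp) z := fun z hz ↦
    ((hγ₂.contDiffAt (hU₂o.mem_nhds hz)).add ((hΘ₂c z hz).const_smul _)).add contDiffAt_const
  have hev1 : ∀ z ∈ U₁, h =ᶠ[𝓝 z] fun w ↦ γ₁ w + (-κ) • Θ₁ w := fun z hz ↦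
    eventually_of_mem (hU₁o.mem_nhds hz) fun w hw ↦ hh1 w hw
  have hev2 : ∀ z ∈ U₂, h =ᶠ[𝓝 z] fun w ↦ γ₂ w + (-κ) • Θ₂ w + Cp := fun z hz ↦
    eventually_of_mem (hU₂o.mem_nhds hz) fun w hw ↦ hh2 w hw
  have hsmooth : ContDiffOn ℝ ∞ h P := by
    intro z hz
    rcases hPU z hz with hz1 | hz2
    · exact ((hF1 z hz1).congr_of_eventuallyEq (hev1 z hz1)).contDiffWithinAt
    · exact ((hF2 z hz2).congr_of_eventuallyEq (hev2 z hz2)).contDiffWithinAt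
  -- `dh = β - κ dϑ`
  have hdh : ∀ z ∈ P, extDeriv h z =
      β z + (-κ) • ofSubsingleton ℝ ℂ ℝ (0 : Fin 1) (imCLM.comp (z⁻¹ • (1 : ℂ →L[ℝ] ℂ))) := by
    intro z hz
    rcases hPU z hz with hz1 | hz2
    · rw [(hev1 z hz1).extDeriv_eq]
      have h1 : DifferentiableAt ℝ γ₁ z :=
        (hγ₁.contDiffAt (hU₁o.mem_nhds hz1)).differentiableAt (by simp)
      have h2 : DifferentiableAt ℝ Θ₁ z := (hΘ₁c z hz1).differentiableAt (by simp)
      rw [show (fun w ↦ γ₁ w + (-κ) • Θ₁ w) = γ₁ + (-κ) • Θ₁ from rfl,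
        extDeriv_add h1 (h2.const_smul _), extDeriv_smul, hdγ₁ z hz1, hΘ₁,
        extDeriv_constOfIsEmpty_eq_of_hasFDerivAt (hasFDerivAt_arg hz1.2)]
    · rw [(hev2 z hz2).extDeriv_eq]
      have h1 : DifferentiableAt ℝ γ₂ z :=
        (hγ₂.contDiffAt (hU₂o.mem_nhds hz2)).differentiableAt (by simp)
      have h2 : DifferentiableAt ℝ Θ₂ z := (hΘ₂c z hz2).differentiableAt (by simp)
      rw [show (fun w ↦ γ₂ w + (-κ) • Θ₂ w + Cp) = (γ₂ + (-κ) • Θ₂) + fun _ ↦ Cp from rfl,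
        extDeriv_add (h1.add (h2.const_smul _)) (differentiableAt_const _),
        extDeriv_add h1 (h2.const_smul _), extDeriv_smul, hdγ₂ z hz2, hΘ₂,
        extDeriv_constOfIsEmpty_eq_of_hasFDerivAt (hasFDerivAt_arg_neg_add_pi hz2.2),
        extDeriv_const_eq_zero, add_zero]
  refine ⟨κ, h, hsmooth, fun x hx ↦ ?_⟩
  rw [hdh x hx]
  ext v
  simp only [ContinuousAlternatingMap.add_apply, ContinuousAlternatingMap.smul_apply, smul_eq_mul]
  ring

/-! ### Uniqueness of the wrapping number -/

/-- **`dϑ` is not exact on a punctured disc; the coefficient `κ` is unique.**  If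
`κ dϑ + dh = κ' dϑ + dh'` on `𝔻_δ ∖ {0}` (`δ > 0`) for `0`-forms `h, h'` differentiable there,
then `κ = κ'`: on each slit disc `h' - h - (κ - κ') arg` is constant, and comparing the two slit
discs on the upper and lower half discs gives `2π (κ - κ') = 0`.  (This is what makes McLean's
wrapping number an invariant of `θ`; McLean 2012, p. 36.)
[cite: Mclean2012, p. 36 (wrapping number)] -/
theorem smul_angular_unique {δ : ℝ} (hδ : 0 < δ) {κ κ' : ℝ} {h h' : ℂ → ℂ [⋀^Fin 0]→L[ℝ] ℝ}
    (hh : DifferentiableOn ℝ h (ball (0 : ℂ) δ \ {0}))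
    (hh' : DifferentiableOn ℝ h' (ball (0 : ℂ) δ \ {0}))
    (heq : ∀ x ∈ ball (0 : ℂ) δ \ {0},
      κ • ofSubsingleton ℝ ℂ ℝ (0 : Fin 1) (imCLM.comp (x⁻¹ • (1 : ℂ →L[ℝ] ℂ))) + extDeriv h x =
      κ' • ofSubsingleton ℝ ℂ ℝ (0 : Fin 1) (imCLM.comp (x⁻¹ • (1 : ℂ →L[ℝ] ℂ))) +
        extDeriv h' x) : κ = κ' := by
  -- the sets (as in the existence proof)
  set P : Set ℂ := ball (0 : ℂ) δ \ {0} with hP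
  set U₁ : Set ℂ := ball (0 : ℂ) δ ∩ slitPlane with hU₁
  set U₂ : Set ℂ := ball (0 : ℂ) δ ∩ -slitPlane with hU₂
  have hU₁o : IsOpen U₁ := isOpen_ball.inter isOpen_slitPlane
  have hU₂o : IsOpen U₂ := isOpen_ball.inter isOpen_slitPlane.neg
  have ha : ((δ / 2 : ℝ) : ℂ) ∈ ball (0 : ℂ) δ := by
    rw [Metric.mem_ball, dist_zero_right, norm_real, Real.norm_eq_abs, abs_of_pos (by positivity)]
    linarith
  have hU₁s : StarConvex ℝ ((δ / 2 : ℝ) : ℂ) U₁ :=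
    ((convex_ball (0 : ℂ) δ).starConvex ha).inter (starConvex_ofReal_slitPlane (by positivity))
  have hU₂s : StarConvex ℝ (-((δ / 2 : ℝ) : ℂ)) U₂ := by
    refine ((convex_ball (0 : ℂ) δ).starConvex ?_).inter
      (starConvex_ofReal_slitPlane (by positivity : (0 : ℝ) < δ / 2)).neg
    rw [Metric.mem_ball, dist_zero_right, norm_neg, norm_real, Real.norm_eq_abs,
      abs_of_pos (by positivity)]
    linarith
  have hU₁P : U₁ ⊆ P := fun z hz ↦ ⟨hz.1, slitPlane_ne_zero hz.2⟩
  have hU₂P : U₂ ⊆ P := fun z hz ↦ ⟨hz.1, fun h0 ↦ by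
    have : -z ∈ slitPlane := hz.2
    rw [show z = 0 from h0, neg_zero] at this
    exact slitPlane_ne_zero this rfl⟩
  -- two test points, upper and lower
  set p : ℂ := ((δ / 2 : ℝ) : ℂ) * I with hp
  set q : ℂ := -(((δ / 2 : ℝ) : ℂ) * I) with hq
  have hpb : p ∈ ball (0 : ℂ) δ := by
    rw [Metric.mem_ball, dist_zero_right, hp, norm_mul, norm_I, mul_one, norm_real,
      Real.norm_eq_abs, abs_of_pos (by positivity)]
    linarith
  have hqb : q ∈ ball (0 : ℂ) δ := by
    rw [Metric.mem_ball, dist_zero_right, hq, norm_neg, norm_mul, norm_I, mul_one, norm_real,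
      Real.norm_eq_abs, abs_of_pos (by positivity)]
    linarith
  have hpim : 0 < p.im := by simp [hp]; positivity
  have hqim : q.im < 0 := by simp [hq]; positivity
  have hp1 : p ∈ U₁ := ⟨hpb, Or.inr hpim.ne'⟩
  have hq1 : q ∈ U₁ := ⟨hqb, Or.inr hqim.ne⟩
  have hp2 : p ∈ U₂ :=
    ⟨hpb, Or.inr (by show (-p).im ≠ 0; rw [neg_im]; exact neg_ne_zero.2 hpim.ne')⟩
  have hq2 : q ∈ U₂ :=
    ⟨hqb, Or.inr (by show (-q).im ≠ 0; rw [neg_im]; exact neg_ne_zero.2 hqim.ne)⟩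
  -- the functions `G_i = h' - h - (κ - κ') Θ_i` have `dG_i = 0` on `U_i`
  set μ : ℝ := κ - κ' with hμ
  set Θ₁ : ℂ → ℂ [⋀^Fin 0]→L[ℝ] ℝ := fun z ↦ constOfIsEmpty ℝ ℂ (Fin 0) (arg z) with hΘ₁
  set Θ₂ : ℂ → ℂ [⋀^Fin 0]→L[ℝ] ℝ := fun z ↦ constOfIsEmpty ℝ ℂ (Fin 0) (arg (-z) + π) with hΘ₂
  set G₁ : ℂ → ℂ [⋀^Fin 0]→L[ℝ] ℝ := h' + (-1 : ℝ) • h + (-μ) • Θ₁ with hG₁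
  set G₂ : ℂ → ℂ [⋀^Fin 0]→L[ℝ] ℝ := h' + (-1 : ℝ) • h + (-μ) • Θ₂ with hG₂
  have hΘ₁d : ∀ z ∈ U₁, DifferentiableAt ℝ Θ₁ z := fun z hz ↦
    (contDiffAt_constOfIsEmpty (contDiffAt_arg hz.2)).differentiableAt (by simp)
  have hΘ₂d : ∀ z ∈ U₂, DifferentiableAt ℝ Θ₂ z := fun z hz ↦
    (contDiffAt_constOfIsEmpty (contDiffAt_arg_neg_add_pi hz.2)).differentiableAt (by simp)
  have hhd : ∀ z ∈ P, DifferentiableAt ℝ h z := fun z hz ↦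
    hh.differentiableAt ((isOpen_ball.sdiff isClosed_singleton).mem_nhds hz)
  have hh'd : ∀ z ∈ P, DifferentiableAt ℝ h' z := fun z hz ↦
    hh'.differentiableAt ((isOpen_ball.sdiff isClosed_singleton).mem_nhds hz)
  have key : ∀ z ∈ P, extDeriv h' z + (-1 : ℝ) • extDeriv h z =
      μ • ofSubsingleton ℝ ℂ ℝ (0 : Fin 1) (imCLM.comp (z⁻¹ • (1 : ℂ →L[ℝ] ℂ))) := by
    intro z hz
    have h := congrArg (fun w : ℂ [⋀^Fin 1]→L[ℝ] ℝ ↦ fun v ↦ w v) (heq z hz)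
    ext v
    have hv := congrFun h v
    simp only [ContinuousAlternatingMap.add_apply, ContinuousAlternatingMap.smul_apply,
      smul_eq_mul] at hv
    simp only [ContinuousAlternatingMap.add_apply, ContinuousAlternatingMap.smul_apply,
      smul_eq_mul, hμ]
    linarith
  have hdG₁ : ∀ z ∈ U₁, extDeriv G₁ z = 0 := by
    intro z hz
    have hz' := hU₁P hz
    rw [hG₁, extDeriv_add ((hh'd z hz').add ((hhd z hz').const_smul _)) ((hΘ₁d z hz).const_smul _),
      extDeriv_add (hh'd z hz') ((hhd z hz').const_smul _), extDeriv_smul, extDeriv_smul,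
      key z hz', hΘ₁, extDeriv_constOfIsEmpty_eq_of_hasFDerivAt (hasFDerivAt_arg hz.2)]
    simp
  have hdG₂ : ∀ z ∈ U₂, extDeriv G₂ z = 0 := by
    intro z hz
    have hz' := hU₂P hz
    rw [hG₂, extDeriv_add ((hh'd z hz').add ((hhd z hz').const_smul _)) ((hΘ₂d z hz).const_smul _),
      extDeriv_add (hh'd z hz') ((hhd z hz').const_smul _), extDeriv_smul, extDeriv_smul,
      key z hz', hΘ₂, extDeriv_constOfIsEmpty_eq_of_hasFDerivAt (hasFDerivAt_arg_neg_add_pi hz.2)]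
    simp
  have hG₁diff : DifferentiableOn ℝ G₁ U₁ := fun z hz ↦
    (((hh'd z (hU₁P hz)).add ((hhd z (hU₁P hz)).const_smul _)).add
      ((hΘ₁d z hz).const_smul _)).differentiableWithinAt
  have hG₂diff : DifferentiableOn ℝ G₂ U₂ := fun z hz ↦
    (((hh'd z (hU₂P hz)).add ((hhd z (hU₂P hz)).const_smul _)).add
      ((hΘ₂d z hz).const_smul _)).differentiableWithinAt
  -- constancy on the slit discs
  have hc1 : G₁ p = G₁ q :=
    (eq_of_extDeriv_eq_zero_of_starConvex hU₁o hU₁s hG₁diff hdG₁ hp1).trans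
      (eq_of_extDeriv_eq_zero_of_starConvex hU₁o hU₁s hG₁diff hdG₁ hq1).symm
  have hc2 : G₂ p = G₂ q :=
    (eq_of_extDeriv_eq_zero_of_starConvex hU₂o hU₂s hG₂diff hdG₂ hp2).trans
      (eq_of_extDeriv_eq_zero_of_starConvex hU₂o hU₂s hG₂diff hdG₂ hq2).symm
  -- `G₂ - G₁ = -μ (Θ₂ - Θ₁)` is `0` at `p` and `-2πμ` at `q`
  have hdiff : ∀ z, G₂ z - G₁ z = (-μ) • (Θ₂ z - Θ₁ z) := fun z ↦ by
    simp only [hG₁, hG₂, Pi.add_apply, Pi.smul_apply, smul_sub]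
    abel
  have hΘp : Θ₂ p - Θ₁ p = 0 := by
    simp only [hΘ₁, hΘ₂, arg_neg_add_pi_of_im_pos hpim, sub_self]
  have hΘq : Θ₂ q - Θ₁ q = constOfIsEmpty ℝ ℂ (Fin 0) (2 * π) := by
    ext v
    simp [hΘ₁, hΘ₂, arg_neg_add_pi_of_im_neg hqim]
  have h0 : (-μ) • constOfIsEmpty ℝ ℂ (Fin 0) (2 * π) = 0 := by
    rw [← hΘq, ← hdiff q, ← hc1, ← hc2, hdiff p, hΘp, smul_zero]
  have h1 : (-μ) * (2 * π) = 0 := by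
    have := congrArg (fun g : ℂ [⋀^Fin 0]→L[ℝ] ℝ ↦ g ![]) h0
    exact this
  rcases mul_eq_zero.1 h1 with h2 | h2
  · linarith
  · exfalso; linarith [Real.pi_pos]

end Literature.Geometry.Symplectic
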